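import Summits.PneNP.PneNP.Theorems.PstarSAPeelStep

/-!
# Sherali–Adams laws for typed `P⋆` fibres, III: normalisation and consistency under boundary expansion (T21.1a)

FRONTIER range-avoidance ladder, rung F-N3 context — restricted-model bookkeeping for the Sherali–Adams hierarchy
(`PstarSALevel.SAFeasible`); nothing here bears on `P` vs `NP`.  Cell `pnp-ideate`, ROUND-21 seed §8, item T21.1a.

This is the analogue, for TYPED pure-`P⋆` instances and an ARBITRARY target `y`, of Benabbas–Georgiou–Magen–Tulsiani
2012, Lemma 3.2 with Claim 3.3 (Theory Comput. 8, §3.2), for the reweighted laws `law I y S` of part II: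

* `exists_two_priv` (Claim 3.3's step): if a family `J` of outputs has MORE boundary variables outside `T` than members,
  some member has at least two private variables outside `T` (pigeonhole over `bdry J \ T ⊆ ⋃_j priv_J(j) \ T`);
* `sum_cylT_peel` (Lemma 3.2's computation): if every non-empty sub-family of `E` is strictly boundary expanding off
  `T` (`StrictExpandingOff I T E` — what "`G|−T` is `(r, 1+δ)`-boundary expanding" gives for `|E| ≤ r`), then adding
  `E` to the dominated family `dom T` does not change any `T`-cylinder mass: the members of `E` are peeled one at a time
  (`peel_step`) inside the `T`-cylinder (`sum_eq_of_cylOff`);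
* consequences in the vocabulary of `PstarSALevel`: **consistency** `law_consistent` (`cyl (law S) T = cyl (law T) T`
  for `T ⊆ S` when `dom S \ dom T` is strictly expanding off `T`), **normalisation** `law_total` (`Σ_x law S x = 1`
  when `dom S` is strictly expanding — `Z_S = 1` identically, the point of the reweighting), in particular under
  `PstarSALevel.BoundaryExpanding r I` whenever `#dom S ≤ r` (`law_total_of_boundaryExpanding`); sign and support are
  `law_nonneg` / `law_support` (part II).

What this does NOT yet give: `SAFeasible t I y` itself — as in BGMT, `law S₂` and `law S₁` are consistent only when
`G|−S₁` expands, so the Sherali–Adams family is `S ↦ law (closure S)` for an expansion-correcting closure (BGMT Thm 3.1,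
`PstarSAClosure.exists_closure`), assembled by `PstarSAAssembly.saFeasible_of_closure` with `P := law I y`,
`h32 := law_consistent`, `htotal := law_total` (the leaf).
-/

set_option linter.dupNamespace false

open Finset Literature.Computability.Complexity
open Summit.PneNP.PneNP.Theorems.PstarPairwise (rho lp)
open Summit.PneNP.PneNP.Theorems.PstarSALevel (varSet cyl bdry BoundaryExpanding)

namespace Summit.PneNP.PneNP.Theorems.PstarSAPeeling

variable {n m : ℕ}

/-! ## Boundary variables are private variables; the pigeonhole of Claim 3.3 -/

/-- A private variable of `j ∈ J` is one read by `j` alone among `J`. -/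
theorem mem_priv_iff {I : LocalMap 4 n m} {J : Finset (Fin m)} {j : Fin m} (hj : j ∈ J) {v : Fin n} :
    v ∈ priv I J j ↔ (J.filter fun j' => v ∈ varSet I j') = {j} := by
  rw [priv, mem_filter, eq_singleton_iff_unique_mem]
  simp only [mem_filter]
  constructor
  · rintro ⟨hv, h⟩
    exact ⟨⟨hj, hv⟩, fun j' hj' => by_contra fun hne => h j' hj'.1 hne hj'.2⟩
  · rintro ⟨⟨-, hv⟩, h⟩
    exact ⟨hv, fun j' hj' hne hv' => hne (h j' ⟨hj', hv'⟩)⟩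

/-- **Boundary = union of private parts**: a boundary variable of `J` is a private variable of some member of `J`. -/
theorem mem_bdry_iff {I : LocalMap 4 n m} {J : Finset (Fin m)} {v : Fin n} :
    v ∈ bdry I J ↔ ∃ j ∈ J, v ∈ priv I J j := by
  unfold PstarSALevel.bdry
  rw [mem_filter, card_eq_one]
  simp only [mem_univ, true_and]
  constructor
  · rintro ⟨j, hj⟩
    have hjJ : j ∈ J := (mem_filter.1 (hj ▸ mem_singleton_self j)).1
    exact ⟨j, hjJ, (mem_priv_iff hjJ).2 hj⟩
  · rintro ⟨j, hjJ, hv⟩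
    exact ⟨j, (mem_priv_iff hjJ).1 hv⟩

/-- The boundary outside `T` is covered by the private parts outside `T`. -/
theorem bdry_sdiff_subset (I : LocalMap 4 n m) (J : Finset (Fin m)) (T : Finset (Fin n)) :
    bdry I J \ T ⊆ J.biUnion fun j => priv I J j \ T := by
  intro v hv
  rw [mem_sdiff, mem_bdry_iff] at hv
  obtain ⟨⟨j, hj, hvj⟩, hvT⟩ := hv
  exact mem_biUnion.2 ⟨j, hj, mem_sdiff.2 ⟨hvj, hvT⟩⟩

/-- **Claim 3.3's step (pigeonhole)**: more boundary variables outside `T` than outputs forces an output with at least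
two private variables outside `T`. -/
theorem exists_two_priv {I : LocalMap 4 n m} {J : Finset (Fin m)} {T : Finset (Fin n)}
    (h : J.card < (bdry I J \ T).card) : ∃ j ∈ J, 2 ≤ (priv I J j \ T).card := by
  by_contra hcon
  push Not at hcon
  have h1 : (bdry I J \ T).card ≤ ∑ j ∈ J, (priv I J j \ T).card :=
    (card_le_card (bdry_sdiff_subset I J T)).trans card_biUnion_le
  have h2 : ∑ j ∈ J, (priv I J j \ T).card ≤ ∑ j ∈ J, 1 := sum_le_sum fun j hj => by have := hcon j hj; omega
  rw [sum_const, smul_eq_mul, mul_one] at h2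
  omega

/-! ## Strict boundary expansion off `T` -/

/-- STRICT BOUNDARY EXPANSION of a family `E` of outputs OFF the variable set `T`: every non-empty sub-family has more
boundary variables outside `T` than members.  (`(r, 1+δ)`-boundary expansion of BGMT's `G|−T`, restricted to `E` with
`#E ≤ r`, gives exactly this; for `T = ∅` it follows from `PstarSALevel.BoundaryExpanding r I`.) -/
def StrictExpandingOff (I : LocalMap 4 n m) (T : Finset (Fin n)) (E : Finset (Fin m)) : Prop :=
  ∀ J ⊆ E, J.Nonempty → J.card < (bdry I J \ T).card

/-- Strict expansion passes to sub-families. -/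
theorem StrictExpandingOff.mono {I : LocalMap 4 n m} {T : Finset (Fin n)} {E E' : Finset (Fin m)}
    (h : StrictExpandingOff I T E) (hE : E' ⊆ E) : StrictExpandingOff I T E' :=
  fun J hJ hne => h J (hJ.trans hE) hne

/-- `(r, 3/2)`-boundary expansion gives strict expansion (off `∅`) of every family of at most `r` outputs. -/
theorem strictExpandingOff_of_boundaryExpanding {r : ℕ} {I : LocalMap 4 n m} (hB : BoundaryExpanding r I)
    {E : Finset (Fin m)} (hE : E.card ≤ r) : StrictExpandingOff I ∅ E := by
  intro J hJ hne
  have h := hB J ((card_le_card hJ).trans hE)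
  have hpos : 0 < J.card := card_pos.2 hne
  rw [sdiff_empty]
  omega

/-! ## Peeling a strictly expanding family inside a `T`-cylinder -/

/-- The outputs dominated by `T` read no variable outside `T`; so a private variable of `j₀` within `E`, outside `T`,
stays private within `dom T ∪ E`. -/
theorem priv_sdiff_subset_priv_union (I : LocalMap 4 n m) (T : Finset (Fin n)) (E : Finset (Fin m)) (j₀ : Fin m) :
    priv I E j₀ \ T ⊆ priv I (dom I T ∪ E) j₀ := by
  intro v hv
  rw [mem_sdiff] at hv
  obtain ⟨hv, hvT⟩ := hv
  refine mem_filter.2 ⟨priv_subset I E j₀ hv, fun j hj hne hvj => ?_⟩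
  rcases mem_union.1 hj with hj | hj
  · exact hvT (mem_dom.1 hj hvj)
  · exact not_mem_of_mem_priv hv hj hne hvj

/-- An output with a private variable outside `T` is not dominated by `T`. -/
theorem not_mem_dom_of_priv_sdiff {I : LocalMap 4 n m} {T : Finset (Fin n)} {E : Finset (Fin m)} {j₀ : Fin m}
    (h : (priv I E j₀ \ T).Nonempty) : j₀ ∉ dom I T := by
  obtain ⟨v, hv⟩ := h
  rw [mem_sdiff] at hv
  exact fun hj => hv.2 (mem_dom.1 hj (priv_subset I E j₀ hv.1))

/-- The `T`-cylinder of `a` is closed under changing coordinates outside `T`. -/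
theorem cylT_closed {T F : Finset (Fin n)} (hFT : ∀ v ∈ F, v ∉ T) (a : Fin n → Bool) :
    ∀ x ∈ univ.filter (fun x : Fin n → Bool => ∀ i ∈ T, x i = a i), ∀ β ∈ cylOff F x,
      β ∈ univ.filter (fun x : Fin n → Bool => ∀ i ∈ T, x i = a i) := by
  intro x hx β hβ
  simp only [mem_filter, mem_univ, true_and] at hx ⊢
  intro i hi
  rw [mem_cylOff.1 hβ i (fun hiF => hFT i hiF hi), hx i hi]

/-- **BGMT Lemma 3.2, the computation.**  On a typed pure-`P⋆` instance, adding to `dom T` a family `E` that is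
strictly boundary expanding off `T` does not change the mass of any `T`-cylinder: the members of `E` are peeled one
at a time. -/
theorem sum_cylT_peel {I : LocalMap 4 n m} (hI : I.IsPure xorAndPred) (hT : PstarTyped.Typed I) (y : Fin m → Bool)
    (T : Finset (Fin n)) : ∀ (k : ℕ) (E : Finset (Fin m)), E.card = k → StrictExpandingOff I T E → ∀ a : Fin n → Bool,
      ∑ x ∈ univ.filter (fun x : Fin n → Bool => ∀ i ∈ T, x i = a i), W I y (dom I T ∪ E) x =
        ∑ x ∈ univ.filter (fun x : Fin n → Bool => ∀ i ∈ T, x i = a i), W I y (dom I T) x := by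
  intro k
  induction k with
  | zero =>
    intro E hE _ a
    rw [card_eq_zero.1 hE, union_empty]
  | succ k ih =>
    intro E hE hexp a
    have hne : E.Nonempty := card_pos.1 (by omega)
    obtain ⟨j₀, hj₀E, h2⟩ := exists_two_priv (hexp E Subset.rfl hne)
    set F := priv I E j₀ \ T with hF
    have hFne : F.Nonempty := card_pos.1 (by omega)
    have hj₀T : j₀ ∉ dom I T := not_mem_dom_of_priv_sdiff hFne
    have hj₀ : j₀ ∈ dom I T ∪ E := mem_union_right _ hj₀E
    have hFpriv : F ⊆ priv I (dom I T ∪ E) j₀ := priv_sdiff_subset_priv_union I T E j₀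
    have hFT : ∀ v ∈ F, v ∉ T := fun v hv => (mem_sdiff.1 hv).2
    have herase : (dom I T ∪ E).erase j₀ = dom I T ∪ E.erase j₀ := by
      rw [erase_union_distrib, erase_eq_of_notMem hj₀T]
    calc ∑ x ∈ univ.filter (fun x : Fin n → Bool => ∀ i ∈ T, x i = a i), W I y (dom I T ∪ E) x
        = ∑ x ∈ univ.filter (fun x : Fin n → Bool => ∀ i ∈ T, x i = a i), W I y ((dom I T ∪ E).erase j₀) x :=
          sum_eq_of_cylOff (cylT_closed hFT a) fun x _ => peel_step hI hT y hj₀ hFpriv h2 x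
      _ = ∑ x ∈ univ.filter (fun x : Fin n → Bool => ∀ i ∈ T, x i = a i), W I y (dom I T ∪ E.erase j₀) x := by
          rw [herase]
      _ = ∑ x ∈ univ.filter (fun x : Fin n → Bool => ∀ i ∈ T, x i = a i), W I y (dom I T) x :=
          ih (E.erase j₀) (by rw [card_erase_of_mem hj₀E]; omega) (hexp.mono (erase_subset j₀ E)) a

/-! ## Consistency and normalisation of the laws -/

/-- **CONSISTENCY (BGMT Lemma 3.2 for typed `P⋆`, reweighted).**  If `T ⊆ S` and the outputs dominated by `S` but not
by `T` are strictly boundary expanding off `T`, then `law I y S` and `law I y T` give every `T`-cylinder the same mass. -/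
theorem law_consistent {I : LocalMap 4 n m} (hI : I.IsPure xorAndPred) (hT : PstarTyped.Typed I) (y : Fin m → Bool)
    {S T : Finset (Fin n)} (hTS : T ⊆ S) (hexp : StrictExpandingOff I T (dom I S \ dom I T)) (a : Fin n → Bool) :
    cyl (law I y S) T a = cyl (law I y T) T a := by
  unfold PstarSALevel.cyl law
  rw [← union_sdiff_of_subset (dom_mono I hTS)]
  exact sum_cylT_peel hI hT y T _ _ rfl hexp a

/-- No output is dominated by `∅` (every output reads four variables). -/
theorem dom_empty (I : LocalMap 4 n m) : dom I ∅ = ∅ := by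
  ext j
  simp only [mem_dom, subset_empty, notMem_empty, iff_false]
  intro h
  have hv : I.vars j 0 ∈ varSet I j := mem_image_of_mem _ (mem_univ _)
  rw [h] at hv
  exact notMem_empty _ hv

/-- The weight of the empty family is the bias-product law. -/
theorem W_empty (I : LocalMap 4 n m) (y : Fin m → Bool) (x : Fin n → Bool) :
    W I y ∅ x = ∏ v, rho (bias I v) (x v) := by
  unfold W ex deg
  simp

/-- The bias-product law has total mass `1`. -/
theorem sum_W_empty (I : LocalMap 4 n m) (y : Fin m → Bool) : ∑ x, W I y ∅ x = 1 := by
  have hc : cylOff (univ : Finset (Fin n)) (fun _ => true) = univ :=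
    eq_univ_of_forall fun β => mem_cylOff.2 fun v hv => absurd (mem_univ v) hv
  have h := sum_cylOff_prod_rho I univ (fun _ => true)
  rw [hc] at h
  simpa only [W_empty] using h

/-- **NORMALISATION (`Z_S = 1`).**  If the outputs dominated by `S` are strictly boundary expanding, `law I y S` is a
probability law. -/
theorem law_total {I : LocalMap 4 n m} (hI : I.IsPure xorAndPred) (hT : PstarTyped.Typed I) (y : Fin m → Bool)
    {S : Finset (Fin n)} (hexp : StrictExpandingOff I ∅ (dom I S)) : ∑ x, law I y S x = 1 := by
  have h := sum_cylT_peel hI hT y ∅ _ (dom I S) rfl hexp (fun _ => true)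
  have hu : univ.filter (fun x : Fin n → Bool => ∀ i ∈ (∅ : Finset (Fin n)), x i = true) = univ :=
    filter_true_of_mem fun x _ => by simp
  rw [hu, dom_empty, empty_union, sum_W_empty] at h
  exact h

/-- Normalisation under `(r, 3/2)`-boundary expansion, for sets dominating at most `r` outputs. -/
theorem law_total_of_boundaryExpanding {r : ℕ} {I : LocalMap 4 n m} (hI : I.IsPure xorAndPred)
    (hT : PstarTyped.Typed I) (hB : BoundaryExpanding r I) (y : Fin m → Bool) {S : Finset (Fin n)}
    (hS : (dom I S).card ≤ r) : ∑ x, law I y S x = 1 :=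
  law_total hI hT y (strictExpandingOff_of_boundaryExpanding hB hS)

end Summit.PneNP.PneNP.Theorems.PstarSAPeeling
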